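import Summits.BirchSwinnertonDyer.BirchSwinnertonDyer.Theorems.PrintCf2SplitBadTwoFrameFieldPinning
import Summits.BirchSwinnertonDyer.BirchSwinnertonDyer.Theorems.PrintCf2SplitBadTwoCMPrimaryDecompositionAtTwo
import HarnessLib

set_option linter.dupNamespace false
set_option autoImplicit false

/-!
# Crux `PrintCf2.SplitBadTwoRankOneOfFacts` (stmt-BirchSwinnertonDyer-20368), road α — FRAME PINNING, V:
# in every frame the CM endomorphism `π = (1+√−7)/2` is `K`-RATIONAL and `E_K[2^∞] = E[𝔭^∞] ⊕ E[𝔭̄^∞]`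

Width seat `bsd-line-cf2-p1-w6` (brick B8 «pinning lemma», 2026-08-28); sequel of file IIIb
`PrintCf2SplitBadTwoFrameFieldPinning.lean` (K-pinning: the frame field contains `θ`, `θ² = −7`). Helper
`--supports` stmt-BirchSwinnertonDyer-20368; THEOREMS ONLY.

The v9.1 research stub S3b′ `stub_restrictedMainConj_two` CONCLUDES, for an arbitrary frame (`K` imaginary
quadratic with `2 = v v̄`, `ψ` pinned to `W ≅ cm7^{(d)}`), with `∃ (π : (W.baseChange K).endRing), π² = π − 2,
∃ r, r² = r − 2, …` — objects that exist only when `√−7 ∈ K`. -w2 g7's `CMPrimes.exists_cmPrimaryDecomposition_two`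
constructs them over any number field `L ∋ θ`, `θ² = −7`; file IIIb proves `θ` exists in every frame. This
file composes the two, so the S3b′ prover gets the `K`-rational `π`, the root `r` and the `Γ_K`-stable
decomposition `E_K[2^∞] = C₁ ⊕ C₂` from the v9.1 binders ALONE (no `θ`-binder):

* `exists_cmEndo_endRing_of_frame` — `∃ π ∈ End_K(W_K)`, `π² = π − 2`, `#ker π = #ker (1 − π) = 2`, `Γ_K`-equivariant;
* `exists_cmPrimaryDecomposition_of_frame` — -w2 g7's decomposition VERBATIM, in frame currency.

HONEST FRAMING: glue of two kernel theorems; nothing about BSD; no stub closed. beyond-print theorem: no.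

References: [SilvermanATAEC1994] II §1 Prop. 1.1, §2 Thm. 2.2(b), App. A §3; [Cox2013] §14.B.
-/

noncomputable section

open scoped Classical
open Filter NumberField IsDedekindDomain WeierstrassCurve Field
  Literature.NumberTheory.GaloisRepresentations
  Literature.NumberTheory.EllipticCurves
  Summit.BirchSwinnertonDyer.BirchSwinnertonDyer.Theorems.RamifiedSevenEllipticUnits

namespace Summit.BirchSwinnertonDyer.BirchSwinnertonDyer.Theorems.PrintCf2.FramePinning

variable {K : Type} [Field K] [NumberField K]
variable {d : ℤ} {W : WeierstrassCurve ℚ} [W.IsElliptic] [W.IsGloballyMinimal] {C : VariableChange ℚ}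
  {v vbar : HeightOneSpectrum (𝓞 K)} {ψ : HeckeCharacter K}

/-- **A `K`-RATIONAL CM ENDOMORPHISM IN EVERY FRAME.** For a member `W` (`C • W = cm7^{(d)}`, `d ≠ 0`), a frame
field `K` (imaginary quadratic, two places `v ≠ v̄` above `2`) and ANY Hecke character `ψ` of `K` pinned to `W`:
there is `π ∈ End_K(W_K)` with `π² = π − 2`, `#ker π = #ker (1 − π) = 2`, commuting with `Γ_K` — the
K-pinning (`exists_sq_eq_neg_seven_of_frame`) feeds -w2 g7's `CMPrimes.cmEndo_mem_endRing_of_sq_eq_neg_seven`.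
[cite: SilvermanATAEC1994, II §2 Thm. 2.2(b) (endomorphisms are defined over the CM field)] [cite: Cox2013, §14.B] -/
theorem exists_cmEndo_endRing_of_frame (hd0 : d ≠ 0) (hC : C • W = cm7.quadraticTwist (d : ℚ))
    (hK : IsImaginaryQuadratic K) (hv : ((2 : ℕ) : 𝓞 K) ∈ v.asIdeal) (hvbar : ((2 : ℕ) : 𝓞 K) ∈ vbar.asIdeal)
    (hne : vbar ≠ v) (hpin : ∀ s : ℂ, 3 / 2 < s.re → heckeLFunction ψ s = W.LSeries s) :
    ∃ π : AddMonoid.End (W.baseChange K).geomPoints,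
      π ∈ (W.baseChange K).endRing ∧ π * π = π - 2 ∧
      Nat.card (π : (W.baseChange K).geomPoints →+ (W.baseChange K).geomPoints).ker = 2 ∧
      Nat.card ((1 - π : AddMonoid.End (W.baseChange K).geomPoints) :
        (W.baseChange K).geomPoints →+ (W.baseChange K).geomPoints).ker = 2 ∧
      (∀ (σ : absoluteGaloisGroup K) (P : (W.baseChange K).geomPoints), π (σ • P) = σ • π P) := by
  obtain ⟨⟨θ, hθ⟩, hcm⟩ := exists_sq_eq_neg_seven_of_frame hd0 W hC hK hv hvbar hne hpin
  have hj : W.j = -3375 := by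
    -- `IsCMFieldOfJ K W.j` pins `cmFieldDiscr W.j`, but the direct route is the isomorphism invariance of `j`
    have hdQ : (d : ℚ) ≠ 0 := by exact_mod_cast hd0
    haveI := cm7.isElliptic_quadraticTwist hdQ
    have key : ∀ (V : WeierstrassCurve ℚ) [V.IsElliptic], V = cm7.quadraticTwist (d : ℚ) → V.j = -3375 := by
      rintro V _ rfl
      rw [j_quadraticTwist cm7 hdQ, j_cm7]
    rw [← variableChange_j W C]
    exact key (C • W) hC
  obtain ⟨π, hπ, hrel, hker, hker'⟩ := CMPrimes.exists_cmEndo_baseChange W hj K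
  have hjV : (W.baseChange K).j = -3375 := by simp only [baseChange, map_j, hj]; norm_num
  obtain ⟨hπend, hequiv⟩ := CMPrimes.cmEndo_mem_endRing_of_sq_eq_neg_seven (W.baseChange K) hjV hθ hπ hrel
  exact ⟨π, hπend, hrel, hker, hker', hequiv⟩

/-- **THE CM-PRIME DECOMPOSITION `E_K[2^∞] = E[𝔭^∞] ⊕ E[𝔭̄^∞]` IN EVERY FRAME** — -w2 g7's
`CMPrimes.exists_cmPrimaryDecomposition_two` VERBATIM (K-rational `π`, `π² = π − 2`; the `2`-adic root `r`,
`‖r‖ < 1`; complementary non-zero `Γ_K`-stable eigen-subgroups `C₁`, `C₂`), with its hypothesis «`θ ∈ K`,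
`θ² = −7`» discharged by the K-pinning: available from the v9.1 frame binders alone.
[cite: SilvermanATAEC1994, II §1 Prop. 1.1, II §2 Thm. 2.2(b), App. A §3 (row D = -7)] -/
theorem exists_cmPrimaryDecomposition_of_frame (hd0 : d ≠ 0) (hC : C • W = cm7.quadraticTwist (d : ℚ))
    (hK : IsImaginaryQuadratic K) (hv : ((2 : ℕ) : 𝓞 K) ∈ v.asIdeal) (hvbar : ((2 : ℕ) : 𝓞 K) ∈ vbar.asIdeal)
    (hne : vbar ≠ v) (hpin : ∀ s : ℂ, 3 / 2 < s.re → heckeLFunction ψ s = W.LSeries s) :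
    ∃ (π : AddMonoid.End (W.baseChange K).geomPoints) (r : ℤ_[2])
      (C₁ C₂ : AddSubgroup ((W.baseChange K).geomPrimaryTorsion 2)),
      π ∈ (W.baseChange K).endRing ∧ π * π = π - 2 ∧
      Nat.card (π : (W.baseChange K).geomPoints →+ (W.baseChange K).geomPoints).ker = 2 ∧
      Nat.card ((1 - π : AddMonoid.End (W.baseChange K).geomPoints) :
        (W.baseChange K).geomPoints →+ (W.baseChange K).geomPoints).ker = 2 ∧
      (∀ (σ : absoluteGaloisGroup K) (P : (W.baseChange K).geomPoints), π (σ • P) = σ • π P) ∧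
      r * r = r - 2 ∧ ‖r‖ < 1 ∧
      (∀ x, x ∈ C₁ ↔ ∀ (k : ℕ) (N : ℤ), 2 ^ k • x = 0 →
        ((N : ℤ_[2]) - r) ∈ (Ideal.span {(2 : ℤ_[2]) ^ k} : Ideal ℤ_[2]) →
          π (x : (W.baseChange K).geomPoints) = N • (x : (W.baseChange K).geomPoints)) ∧
      (∀ x, x ∈ C₂ ↔ ∀ (k : ℕ) (N : ℤ), 2 ^ k • x = 0 →
        ((N : ℤ_[2]) - (1 - r)) ∈ (Ideal.span {(2 : ℤ_[2]) ^ k} : Ideal ℤ_[2]) →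
          π (x : (W.baseChange K).geomPoints) = N • (x : (W.baseChange K).geomPoints)) ∧
      C₁ ⊓ C₂ = ⊥ ∧ C₁ ⊔ C₂ = ⊤ ∧ C₁ ≠ ⊥ ∧ C₂ ≠ ⊥ ∧
      (∀ σ : absoluteGaloisGroup K, (∀ x ∈ C₁, σ • x ∈ C₁) ∧ (∀ x ∈ C₂, σ • x ∈ C₂)) := by
  obtain ⟨⟨θ, hθ⟩, -⟩ := exists_sq_eq_neg_seven_of_frame hd0 W hC hK hv hvbar hne hpin
  have hj : W.j = -3375 := by
    have hdQ : (d : ℚ) ≠ 0 := by exact_mod_cast hd0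
    haveI := cm7.isElliptic_quadraticTwist hdQ
    have key : ∀ (V : WeierstrassCurve ℚ) [V.IsElliptic], V = cm7.quadraticTwist (d : ℚ) → V.j = -3375 := by
      rintro V _ rfl
      rw [j_quadraticTwist cm7 hdQ, j_cm7]
    rw [← variableChange_j W C]
    exact key (C • W) hC
  exact CMPrimes.exists_cmPrimaryDecomposition_two W hj K hθ

end Summit.BirchSwinnertonDyer.BirchSwinnertonDyer.Theorems.PrintCf2.FramePinning

end
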